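import Summits.Langlands.Langlands.Statement
import Literature.NumberTheory.GaloisRepresentations.GaloisRepFrobeniusProofs
import HarnessLib

/-!
# Unpacking Satake–Frobenius compatibility in rank two
(route `SkinnerWilesDefectOne`, item stmt-Langlands-12922 `FiveIsogenyEllipticCurves`, helper)

The target `ReducibleOrdinaryModular` of the route concludes with
`Summit.Langlands.SatakeFrobCompatibleAt ι π ρ w`: `π` has a Satake parameter `α` at `w`, `ρ` is
unramified at `w`, and every arithmetic Frobenius at `w` has characteristic polynomial
`arithFrobPolyOfSatake ι q_w 1 α = ∏_{a ∈ α} (X - ι⁻¹(a⁻¹))` on `ρ`.  The headline corollary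
`FiveIsogenyEllipticCurves` wants instead the lang.S28 shape
`∃ α, π.HasSatakeParamAt w α ∧ Σ_{a ∈ α} a⁻¹ = a_w ∧ ∏_{a ∈ α} a⁻¹ = q_w`.  This file proves the
bridge: if in addition `ρ` has Frobenius characteristic polynomial `X² - a X + q` at `w`
(`a ∈ ℤ`, `q ∈ ℕ`), then `Σ a_j⁻¹ = a` and `∏ a_j⁻¹ = q` — uniqueness of the Frobenius
characteristic polynomial over a number field (`GaloisRep.HasFrobCharpolyAt.unique_holds`:
a prime above `w` carries an arithmetic Frobenius) and Vieta for a monic quadratic.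

References: K. Buzzard, T. Gee, *The conjectural connections between automorphic
representations and Galois representations* (2014), §2.1 and Conj. 3.2.1 (L-normalisation,
roots `ι⁻¹(α_j⁻¹)` of the arithmetic Frobenius); J.-P. Serre, *Abelian ℓ-adic representations
and elliptic curves* (1968), Ch. I §2.1, §2.3.
-/

noncomputable section

-- `Summit.Langlands.Langlands.…`: summit = sub-problem name (D-0017 layout), as in every Theorems file here.
set_option linter.dupNamespace false

open scoped NumberField Classical
open Polynomial IsDedekindDomain
open Literature.NumberTheory.Automorphic Literature.NumberTheory.GaloisRepresentations

namespace Summit.Langlands.Langlands.Theorems.FiveIsogenyEllipticCurves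

variable {K : Type} [Field K] [NumberField K] {ℓ : ℕ} [Fact ℓ.Prime]

/-- **Uniqueness of the Frobenius characteristic polynomial of a framed representation** over a
number field: `ρ.HasFrobCharpolyAt w P → ρ.HasFrobCharpolyAt w Q → P = Q` (there is a prime
above `w`, and an arithmetic Frobenius at it).  Framed form of the tree's
`GaloisRep.HasFrobCharpolyAt.unique_holds`.  Serre (1968), Ch. I §2.1. [folklore] -/
theorem framed_hasFrobCharpolyAt_unique {n : ℕ} {ρ : FramedGaloisRep K (PadicAlgCl ℓ) n}
    {w : HeightOneSpectrum (𝓞 K)} {P Q : (PadicAlgCl ℓ)[X]}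
    (hP : ρ.HasFrobCharpolyAt w P) (hQ : ρ.HasFrobCharpolyAt w Q) : P = Q := by
  obtain ⟨𝔓, h𝔓⟩ := HeightOneSpectrum.primesAbove_nonempty w
  obtain ⟨σ, hσ⟩ := HeightOneSpectrum.exists_isArithFrobAt_of_mem_primesAbove_holds h𝔓
  rw [← hP 𝔓 h𝔓 σ hσ, ← hQ 𝔓 h𝔓 σ hσ]

/-- **Vieta for the L-normalised Satake polynomial in rank two.**  If
`arithFrobPolyOfSatake ι q 1 α = ∏_{a ∈ α} (X - ι⁻¹(a⁻¹))` equals `X² - a X + q` in `ℚ̄_ℓ[X]`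
(`a ∈ ℤ`, `q ∈ ℕ`), then `Σ_{a ∈ α} a⁻¹ = a` and `∏_{a ∈ α} a⁻¹ = q` in `ℂ`: `α` has two entries
(degrees), and the multiset `α.map (ι⁻¹ ∘ (·)⁻¹)` of roots has elementary symmetric functions
`a` and `q` (Mathlib `Multiset.prod_X_sub_C_coeff`), which `ι` carries to `ℂ`.
Buzzard–Gee (2014), §2.1. [folklore] -/
theorem sum_prod_inv_of_arithFrobPolyOfSatake_eq (ι : PadicAlgCl ℓ ≃+* ℂ) {q : ℕ} {a : ℤ}
    {α : Multiset ℂ}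
    (h : arithFrobPolyOfSatake ι q 1 α = X ^ 2 - C (a : PadicAlgCl ℓ) * X + C (q : PadicAlgCl ℓ)) :
    (α.map fun z => z⁻¹).sum = (a : ℂ) ∧ (α.map fun z => z⁻¹).prod = (q : ℂ) := by
  set s : Multiset (PadicAlgCl ℓ) := α.map fun z => ι.symm z⁻¹ with hs
  have hprod : (s.map fun r => X - C r).prod =
      X ^ 2 - C (a : PadicAlgCl ℓ) * X + C (q : PadicAlgCl ℓ) := by
    rw [← h, arithFrobPolyOfSatake_one, hs, Multiset.map_map]
    rfl
  -- degree count: `card s = 2`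
  have hdeg : (X ^ 2 - C (a : PadicAlgCl ℓ) * X + C (q : PadicAlgCl ℓ)).natDegree = 2 := by
    compute_degree!
  have hcard : Multiset.card s = 2 := by
    have h1 := Polynomial.natDegree_multiset_prod_X_sub_C_eq_card s
    rw [hprod, hdeg] at h1
    exact h1.symm
  -- write `s = {r₁, r₂}`
  obtain ⟨r₁, r₂, hs12⟩ : ∃ r₁ r₂, s = {r₁, r₂} := by
    rcases Multiset.card_eq_two.mp hcard with ⟨x, y, hxy⟩
    exact ⟨x, y, hxy⟩
  have hpoly : (X - C r₁) * (X - C r₂) = X ^ 2 - C (a : PadicAlgCl ℓ) * X + C (q : PadicAlgCl ℓ) := by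
    rw [← hprod, hs12]
    simp
  have hsum : r₁ + r₂ = (a : PadicAlgCl ℓ) := by
    have h1 := congrArg (fun P : (PadicAlgCl ℓ)[X] => P.coeff 1) hpoly
    have e1 : ((X - C r₁) * (X - C r₂) : (PadicAlgCl ℓ)[X]).coeff 1 = -(r₁ + r₂) := by
      have : ((X - C r₁) * (X - C r₂) : (PadicAlgCl ℓ)[X]) =
          X ^ 2 - C (r₁ + r₂) * X + C (r₁ * r₂) := by
        simp only [map_add, map_mul]; ring
      rw [this]
      simp [coeff_C]
    have e2 : (X ^ 2 - C (a : PadicAlgCl ℓ) * X + C (q : PadicAlgCl ℓ)).coeff 1 = -(a : PadicAlgCl ℓ) := by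
      simp
    rw [e1, e2] at h1
    exact neg_injective h1
  have hmul : r₁ * r₂ = (q : PadicAlgCl ℓ) := by
    have h0 := congrArg (fun P : (PadicAlgCl ℓ)[X] => P.coeff 0) hpoly
    have e1 : ((X - C r₁) * (X - C r₂) : (PadicAlgCl ℓ)[X]).coeff 0 = r₁ * r₂ := by
      simp [coeff_X]
    have e2 : (X ^ 2 - C (a : PadicAlgCl ℓ) * X + C (q : PadicAlgCl ℓ)).coeff 0 = (q : PadicAlgCl ℓ) := by
      simp [coeff_X]
    rw [e1, e2] at h0
    exact h0
  -- transport along `ι`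
  have hmapι : (α.map fun z => z⁻¹) = s.map ι := by
    rw [hs, Multiset.map_map]
    refine Multiset.map_congr rfl fun z _ => ?_
    simp
  rw [hmapι, hs12]
  simp only [Multiset.insert_eq_cons, Multiset.map_cons, Multiset.map_singleton, Multiset.sum_cons,
    Multiset.sum_singleton, Multiset.prod_cons, Multiset.prod_singleton]
  constructor
  · rw [← map_add, hsum, map_intCast]
  · rw [← map_mul, hmul, map_natCast]

/-- **From Satake–Frobenius compatibility to the lang.S28 trace/norm identities.**  If `π` and
`ρ : Γ_K →ₜ* GL₂(ℚ̄_ℓ)` are Satake–Frobenius compatible at `w`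
(`Summit.Langlands.SatakeFrobCompatibleAt ι π ρ w`) and every arithmetic Frobenius at `w` has
characteristic polynomial `X² - a X + q` on `ρ` (`a ∈ ℤ`, `q ∈ ℕ`), then `π` has a Satake
parameter `α` at `w` with `Σ_{z ∈ α} z⁻¹ = a` and `∏_{z ∈ α} z⁻¹ = q`.
Buzzard–Gee (2014), Conj. 3.2.1 (unramified clause) with §2.1. [folklore] -/
theorem exists_hasSatakeParamAt_sum_prod_of_satakeFrobCompatibleAt
    {hcpt : Literature.NumberTheory.Automorphic.isCompact_glFiniteIntegralLevel 2 K} {ι : PadicAlgCl ℓ ≃+* ℂ}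
    {πA : AutomorphicRepData (AutomorphyDatum.gl 2 K hcpt)} {ρ : FramedGaloisRep K (PadicAlgCl ℓ) 2}
    {w : HeightOneSpectrum (𝓞 K)} (h : Summit.Langlands.SatakeFrobCompatibleAt ι πA ρ w)
    {a : ℤ} {q : ℕ}
    (hP : ρ.HasFrobCharpolyAt w (X ^ 2 - C (a : PadicAlgCl ℓ) * X + C (q : PadicAlgCl ℓ))) :
    ∃ α : Multiset ℂ, πA.HasSatakeParamAt w α ∧
      (α.map fun z => z⁻¹).sum = (a : ℂ) ∧ (α.map fun z => z⁻¹).prod = (q : ℂ) := by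
  obtain ⟨α, hα, -, hρ⟩ := h
  have heq := framed_hasFrobCharpolyAt_unique hρ hP
  exact ⟨α, hα, sum_prod_inv_of_arithFrobPolyOfSatake_eq ι heq⟩

end Summit.Langlands.Langlands.Theorems.FiveIsogenyEllipticCurves

end
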